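import Summits.QuantumFields.YangMills.Theorems.BalabanUVNodesK0RecordFormatNamesP0CGuarded
import Summits.QuantumFields.YangMills.Theorems.BalabanUVNodesPortS1G3CDefsL

/-!
# K0⁷ — THE RECORD-SIDE FORMAT NAMES, EDITION 24-L = THE GUARDED P0-ℂ LETTER ON THE LATTICE-DECAY BASE: `P0HolExtAtRecordGL F`
# (= hand-27930-G3C's REPAIRED letter `BalabanUVNodesPortS1.P0HolExtAtRecordL F` — body `P0CarrierClauses ∧ P0CarrierLatticeDecay`, one more absolute constant `δ₁ > 0` —
# with the ONE displayed a₀-GUARD of edition 24 (the consumer's UNIFORM TokE face (G-b)) inserted after `∀ a₀ > 0 →`)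

Cell `ym-nodeO-ideate` ∕ `ym-balaban-port`, DEFINER seat `ym-nodeO-def-1` (gen 37); `--kind definition --supports stmt-QuantumFields-20541 --as helper`; count-neutral.
[I] = [Balaban1987RG1], [15] = [Balaban1985Variational], [16] = [Balaban1985UV3], [B9] = [Balaban1985BackgroundPropagators].

ORDER OF RECORD.  hand-27930-G3C g0 RESULT (nodeO STATUS 2026-08-31T11:05:54Z): `stub_G3C` AS CUT WAS A MIS-CUT — (P4) of `P0CarrierClauses` grants only CUBE-SCALE Schur decay,
while the walk expansion behind `G3CPiecesAt` needs UNIT-LATTICE semi-locality of the carrier ([16] (23)∕(25) p.262 ⇐ [B9] (3.89)∕(3.94)); REPAIR (◆ CRIT-1 g37 stamp l.5243,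
★★★ director-ym №565 (1)): the lattice-decay letter (P4-lat) `P0CarrierLatticeDecay` + `G3CAtRecordL` + `P0HolExtAtRecordL` (✓`…PortS1G3CDefsL`, the hand's leaf).  ★★★ №565 (1)(b) ∕
№566: the guarded letter is REBASED on the L-edition under the NEW NAME `P0HolExtAtRecordGL` (№566's token; ✓p821002's `P0HolExtAtRecordG` has the non-L body ⇒ append-only ⇒
new name), in THIS leaf; ▶ PT-A-1 g8's v3.4 = ONE registration, FOUR re-points: `stub_P0C : ∀ F, P0HolExtAtRecordGL F` · `stub_G3C : ∀ F, G3CAtRecordL F` ·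
`stub_LZdetGlue : ∀ F, P0HolExtAtRecordGL F → G3CAtRecordL F → PortRecordLZdetHalf F` (threads `δ₁`, discharges the guard from ✓`PortRecordLZdetHalf`'s :75 antecedent at
`ε₁ := min a₁ (a₀ ∕ B₃)`) · `stub_FE : ∀ F, PortRecordFEHalfBox F`.  CONSUMER CHECK C-2 (№565 (3)) is CLOSED by a theorem, not an edition: ✓`K0RecordFormatNames.recordUc_antitone`
(`…Lemmas17`) — (P4)'s domain is right AS IS.

THE GUARD (edition 24, ◆ l.5141 (3) ∕ l.5189, face picked by the consumer ▶ PT-A-1 g7 l.5186): ONE displayed HYPOTHESIS right after `∀ a₀ : ℝ, 0 < a₀ →` and before `∃ α₀ α₁` —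
`(∃ ε₁ : ℝ, 0 < ε₁ ∧ ∀ (k n : ℕ) (V : GaugeField (F.P (recordK₀ F Mc k + n)) (k + 1) (SU 2)), PlaqSmall ε₁ V → UkExists F 2 (recordK₀ F Mc k + n) (k + 1) a₀ V ∧ UniqueUkOrbit F 2 (recordK₀ F Mc k + n) (k + 1) a₀ V) →`
(θ-free; reads only `F, Mc, a₀`; above print's ceiling the token is uninhabited and the letter vacuous there; the supplier may let `α₀ α₁` depend on `ε₁`).  WHY: (P2)'s germ
identity reads the selector `UkSel … a₀ …` (`Classical.choose` under `UkExists ∧ UniqueUkOrbit`), meaningless where uniqueness fails; no print gives uniqueness at large `a₀`.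

WHAT THIS FILE IS (definitions + bridges; statement-form; ONE NEW letter name):
* §26i ★ `P0HolExtAtRecordGL (F : T4Family) : Prop` — `P0HolExtAtRecordL`'s prefix∕body BYTE FOR BYTE (`∃ c₀ γ₀ γ₁ δ₁, … ∧ 0 < δ₁ ∧ ∀ δ₀ > 0, ∃ Mth, ∀ Mc ≥ Mth, McGuard → ∀ a₀ > 0,
  ⟨GUARD⟩ → ∃ α₀ α₁, ∀ ε₂₉ > 0, ∀ k, ∃ TC TY TZY AdM AdZ, P0CarrierClauses … ∧ P0CarrierLatticeDecay F δ₀ c₀ δ₁ Mc α₀ α₁ k TY`) with the guard at ◆'s position.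
* `p0HolExtAtRecordGL_of_L : P0HolExtAtRecordL F → P0HolExtAtRecordGL F` (the guard is dropped — GL is WEAKER than L: every supplier of the hand's L-letter supplies GL).
* `p0HolExtAtRecordG_of_GL : P0HolExtAtRecordGL F → P0HolExtAtRecordG F` (the lattice conjunct and `δ₁` are dropped — G is WEAKER than GL).
  So `P0HolExtAtRecord ⟸ P0HolExtAtRecordL ⟹ P0HolExtAtRecordGL ⟹ P0HolExtAtRecordG ⟸ P0HolExtAtRecord`: the three older letters stay in the tree, superseded-harmless.

HONEST FRAMING.  A DISPLAYED STATEMENT — asserted for nothing; its inhabitation is [15] Prop. 9 ∕ Thm 1 (E2) content + [B9] (3.42) ∕ [15] (190) lattice localisation of the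
(2.11) carrier at the record (node00-def-Y M2-ℂ lane), NOT proved here or anywhere in the tree; the ∃-carrier is inhabited NOWHERE today; ⟨27930⟩ OPEN (2∕6 by name),
`stub_P0C ∕ stub_G3C ∕ stub_LZdetGlue ∕ stub_FE` OPEN; ⟨26900⟩ OPEN; K0ᴬ ∕ K1ᴬ ∕ K3ᴬ OPEN; NODE O not inhabited (0∕1); COUNT 8∕28 · K 1∕4 UNMOVED; finite `𝕋⁴_{L^K}` at fixed ε — NOT
continuum ∕ ℝ⁴ ∕ OS; **the Yang–Mills mass gap (Clay) is NOT proved by any of this.**  No `sorry`, `instance`, `notation`; standard axioms.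
-/

noncomputable section

open scoped BigOperators Matrix.Norms.L2Operator Topology
open Filter

namespace Summit.QuantumFields.YangMills.Theorems.K0RecordFormatNames

open Literature.MathematicalPhysics.QuantumFieldTheory.Balaban1983to89
open Literature.MathematicalPhysics.QuantumFieldTheory.Balaban1983to89.Node00
open Literature.MathematicalPhysics.QuantumFieldTheory.Balaban1983to89.T4Continuum (T4Family)
open Summit.QuantumFields.YangMills.Theorems.BalabanUVNodesPortS1 (P0CarrierLatticeDecay P0HolExtAtRecordL)

/-! ## §26i  The guarded P0-ℂ letter on the lattice-decay base -/

/-- ★ **THE GUARDED P0-ℂ LETTER ON THE LATTICE-DECAY BASE, `P0HolExtAtRecordGL F`** — [15] Prop. 9's Gᶜ-extension READ AT THE RECORD's (2.11) CARRIER, k-UNIFORM, in the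
consumer clauses (P1)–(P5) (`P0CarrierClauses`, edition 23, BY NAME) AND the lattice-scale Schur decay (P4-lat) (`BalabanUVNodesPortS1.P0CarrierLatticeDecay`, hand-27930-G3C's repair,
BY NAME), under the composition-checked (Q-ord) prefix: **the absolute constants `c₀ γ₀ γ₁ δ₁` OUTERMOST (`δ₁ > 0` = the unit-lattice localisation rate of the carrier, [B9] (3.42) ∕
[15] (190)), the cube-scale decay rate `δ₀` DEMANDED, the cube threshold `Mth` answering to `δ₀` (and the absolute constants) and bound BEFORE `a₀`, then `Mc`, then `a₀`, then the
a₀-GUARD (the consumer's UNIFORM TokE face: for SOME `ε₁ > 0`, at EVERY member volume `recordK₀ F Mc k + n` and level `k + 1`, every `ε₁`-plaquette-small `V` has a background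
minimiser at radius `a₀` with a UNIQUE critical orbit — so that (P2)'s selector `UkSel … a₀ …` means print's minimiser wherever the letter is used), then the radii `α₀ α₁`
(which may depend on `ε₁`), `ε₂₉`, `k`, and the carriers `(TC, TY, TZY, AdM, AdZ)` LAST**; body `P0CarrierClauses … ∧ P0CarrierLatticeDecay F δ₀ c₀ δ₁ Mc α₀ α₁ k TY`.
The guard is discharged by the (63) glue from ✓`PortRecordLZdetHalf`'s own binder `hUk` at `ε₁ := min a₁ (a₀ ∕ B₃)`; `δ₁` is threaded to `G3CAtRecordL`.  = `P0HolExtAtRecordL`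
with the guard (`p0HolExtAtRecordGL_of_L`); implies `P0HolExtAtRecordG` (`p0HolExtAtRecordG_of_GL`).  DISPLAYED — asserted for nothing; inhabited nowhere today.
[cite: Balaban1985Variational, Prop. 9 p.309, Thm 1 p.279, (117) p.295, (190) p.309; Balaban1985BackgroundPropagators, (3.42) p.399; Balaban1987RG1, (2.11)–(2.12) pp.267–268,
(1.18) p.263, (0.21) p.256; Balaban1985UV3, (63) p.272, (23)–(25) p.262] -/
def P0HolExtAtRecordGL (F : T4Family) : Prop :=
  ∃ c₀ γ₀ γ₁ δ₁ : ℝ, 0 < c₀ ∧ 0 < γ₀ ∧ γ₀ ≤ γ₁ ∧ 0 < δ₁ ∧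
  ∀ δ₀ : ℝ, 0 < δ₀ → ∃ Mth : ℕ, ∀ Mc : ℕ, Mth ≤ Mc → McGuard F Mc →
  ∀ a₀ : ℝ, 0 < a₀ →
  (∃ ε₁ : ℝ, 0 < ε₁ ∧ ∀ (k n : ℕ) (V : GaugeField (F.P (recordK₀ F Mc k + n)) (k + 1) (SU 2)), PlaqSmall ε₁ V →
    UkExists F 2 (recordK₀ F Mc k + n) (k + 1) a₀ V ∧ UniqueUkOrbit F 2 (recordK₀ F Mc k + n) (k + 1) a₀ V) →
  ∃ α₀ α₁ : ℝ, 0 < α₀ ∧ 0 < α₁ ∧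
  ∀ ε₂₉ : ℝ, 0 < ε₂₉ → ∀ k : ℕ,
    ∃ TC TY TZY AdM AdZ, P0CarrierClauses F a₀ δ₀ c₀ γ₀ γ₁ Mc α₀ α₁ ε₂₉ k TC TY TZY AdM AdZ ∧
      P0CarrierLatticeDecay F δ₀ c₀ δ₁ Mc α₀ α₁ k TY

/-- **GL is WEAKER than the hand's L-letter**: `P0HolExtAtRecordL F → P0HolExtAtRecordGL F` (the a₀-guard hypothesis is simply not used) — every supplier of the repaired
unguarded letter supplies this one. [cite: Balaban1985Variational, Prop. 9 p.309 (bookkeeping)] -/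
theorem p0HolExtAtRecordGL_of_L {F : T4Family} (h : P0HolExtAtRecordL F) : P0HolExtAtRecordGL F := by
  obtain ⟨c₀, γ₀, γ₁, δ₁, hc₀, hγ₀, hγ, hδ₁, H⟩ := h
  refine ⟨c₀, γ₀, γ₁, δ₁, hc₀, hγ₀, hγ, hδ₁, fun δ₀ hδ₀ => ?_⟩
  obtain ⟨Mth, hM⟩ := H δ₀ hδ₀
  exact ⟨Mth, fun Mc hMc hG a₀ ha₀ _ => hM Mc hMc hG a₀ ha₀⟩

/-- **G is WEAKER than GL**: `P0HolExtAtRecordGL F → P0HolExtAtRecordG F` (the lattice conjunct (P4-lat) and the constant `δ₁` are dropped) — consumers of edition 24's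
`P0HolExtAtRecordG` are served by any supplier of GL. [cite: Balaban1985Variational, Prop. 9 p.309 (bookkeeping)] -/
theorem p0HolExtAtRecordG_of_GL {F : T4Family} (h : P0HolExtAtRecordGL F) : P0HolExtAtRecordG F := by
  obtain ⟨c₀, γ₀, γ₁, _δ₁, hc₀, hγ₀, hγ, _hδ₁, H⟩ := h
  refine ⟨c₀, γ₀, γ₁, hc₀, hγ₀, hγ, fun δ₀ hδ₀ => ?_⟩
  obtain ⟨Mth, hM⟩ := H δ₀ hδ₀
  refine ⟨Mth, fun Mc hMc hG a₀ ha₀ hTok => ?_⟩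
  obtain ⟨α₀, α₁, hα₀, hα₁, hk⟩ := hM Mc hMc hG a₀ ha₀ hTok
  refine ⟨α₀, α₁, hα₀, hα₁, fun ε₂₉ hε k => ?_⟩
  obtain ⟨TC, TY, TZY, AdM, AdZ, hP, -⟩ := hk ε₂₉ hε k
  exact ⟨TC, TY, TZY, AdM, AdZ, hP⟩

end Summit.QuantumFields.YangMills.Theorems.K0RecordFormatNames

end
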